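import Literature.Geometry.Symplectic.LefschetzBaseModelStein
import HarnessLib

/-!
# The Levi gradient of the model function of the Lefschetz base: the page-angle identity

Topic `Literature/Geometry/Symplectic`; continuation (proofs, one explicit auxiliary definition
`modelFunD`, no named fact) of `LefschetzBaseModelStein.lean` towards the transversality clause
`dθ(R) > 0` of the Reeb criterion for the handle-free base case of
`palf_stein_supportedByBoundaryOpenBook`.  By `SublevelSteinReebGradient.lean` the Reeb field of
the model `{Ψ ≤ 1/4}`, `Ψ = modelFun g ε (qPert δ)`, lifts `V = J₀ G` with `G` the Levi gradient,
`h(G, v) = D²Ψ(G, v) + D²Ψ(J₀G, J₀v) = DΨ(v)`; and `dθ(V) = Im (Dw(J₀G)/w) = Re (Dw(G)/w)` for the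
page angle `θ = arg w`.  Here `W = Dw(G)` is computed:

* §1 `modelFunD`, `hasFDerivAt_modelFun_qPert` — the first derivative
  `DΨ_z(v) = 2Re(w̄ Dw v) + 2(Θ'(s) + ε) Re(x̄ x(v)) + 2εδ m'(t) Re(ȳ y(v))`;
* §2 `levi_polar_modelFun` — polarisation of the Levi form (`levi_modelFun_qPert`):
  `h(G, v) = 4Re(W̄ · Dw v) + 4κ Re(Ā a') + 4εδμ Re(B̄ b')` with `κ = Θ' + sΘ'' + ε`,
  `(A, B) = (x(G), y(G))`, `(a', b') = (x(v), y(v))`, `μ = yMassLevi t`;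
* §3 `reeb_equations` — testing `h(G, ·) = DΨ` on `v = (a', 0), (0, b')` gives the two complex
  equations `8ȳW + 4εδμB = 4ȳw + 2εδm'y`, `-4p̄'W + 4κA = -2p̄'w + 2(Θ'+ε)x`, `W = 2yB - p'A`
  (`p' = dP g x`), whence (`reeb_W_identity`, a `linear_combination`) **the page-angle identity**
  `W · (16tκ + 4εδμ(|p'|² + κ)) = (8tκ + 2εδμ|p'|²) w + 4εδκ m' y² - 2εδμ(Θ'+ε) p' x`.
  Where `t = ‖y‖² > 3/10` (in particular near the binding) `μ = m' = 0` and **`W = w/2`**, so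
  `dθ(V) = 1/2`; the estimate in the remaining region is the business of the sequel.

## References

* J. B. Etnyre, *Lectures on open book decompositions and contact structures*, Clay Math.
  Proc. 5 (2006), Lemma 3.3 and proof of Thm. 5.6. [Etnyre2006]
* I. Torisu, *Convex contact structures and fibered links in 3-manifolds*, IMRN 2000:9, 441–454.
-/

noncomputable section

open scoped Manifold ContDiff Topology ComplexConjugate
open Set Function Complex

namespace Literature.Geometry.Symplectic

open Literature.Topology.FourManifolds Literature.Topology.FourManifolds.LefschetzBase
  LefschetzBaseSteinModel

/-! ### §1 The first derivative of the model function -/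

/-- **The derivative of `Ψ = ‖w‖² + Θ(‖x‖²) + ε(‖x‖² + δ m(‖y‖²))` at `p`**, as a real functional:
`v ↦ 2Re(w̄ Dw v) + 2Θ'(s) Re(x̄ x(v)) + 2ε Re(x̄ x(v)) + 2εδ m'(t) Re(ȳ y(v))`. [folklore] -/
def modelFunD (g : ℕ) (ε δ : ℝ) (p : EuclideanSpace ℝ (Fin 4)) : EuclideanSpace ℝ (Fin 4) →L[ℝ] ℝ :=
  (2 : ℝ) • reMul (conj (w g p)) (wD g p) +
    (2 * deriv convexProfile (‖cx p‖ ^ 2)) • reMul (conj (cx p)) cxL +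
    (2 * ε) • reMul (conj (cx p)) cxL +
    (2 * ε * δ * deriv yMass (‖cy p‖ ^ 2)) • reMul (conj (cy p)) cyL

/-- Unfolding `modelFunD`. [folklore] -/
theorem modelFunD_apply (g : ℕ) (ε δ : ℝ) (p v : EuclideanSpace ℝ (Fin 4)) :
    modelFunD g ε δ p v = 2 * (conj (w g p) * wD g p v).re +
      2 * deriv convexProfile (‖cx p‖ ^ 2) * (conj (cx p) * cx v).re +
      2 * ε * (conj (cx p) * cx v).re +
      2 * ε * δ * deriv yMass (‖cy p‖ ^ 2) * (conj (cy p) * cy v).re := by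
  simp [modelFunD, smul_eq_mul]

/-- **`Ψ` has derivative `modelFunD` at every point.** [folklore] -/
theorem hasFDerivAt_modelFun_qPert (g : ℕ) (ε δ : ℝ) (p : EuclideanSpace ℝ (Fin 4)) :
    HasFDerivAt (modelFun g ε (qPert δ)) (modelFunD g ε δ p) p := by
  have h1 := hasFDerivAt_norm_sq_w g p
  have hΘ : HasDerivAt convexProfile (deriv convexProfile (‖cx p‖ ^ 2)) (‖cx p‖ ^ 2) :=
    ((contDiff_convexProfile.differentiable (by simp)) _).hasDerivAt
  have h2 := hΘ.comp_hasFDerivAt p (hasFDerivAt_norm_sq_cx p)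
  have hm : HasDerivAt yMass (deriv yMass (‖cy p‖ ^ 2)) (‖cy p‖ ^ 2) :=
    ((contDiff_yMass.differentiable (by simp)) _).hasDerivAt
  have h4 := (hm.comp_hasFDerivAt p (hasFDerivAt_norm_sq_cy p)).const_mul δ
  have hq : HasFDerivAt (qPert δ)
      ((2 : ℝ) • reMul (conj (cx p)) cxL +
        δ • (deriv yMass (‖cy p‖ ^ 2) • ((2 : ℝ) • reMul (conj (cy p)) cyL))) p :=
    (hasFDerivAt_norm_sq_cx p).add h4
  have h := (h1.add h2).add (hq.const_mul ε)
  refine h.congr_fderiv ?_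
  ext v
  simp [modelFunD, smul_eq_mul]
  ring

/-- `fderiv` of `Ψ`. [folklore] -/
theorem fderiv_modelFun_qPert (g : ℕ) (ε δ : ℝ) (p : EuclideanSpace ℝ (Fin 4)) :
    fderiv ℝ (modelFun g ε (qPert δ)) p = modelFunD g ε δ p :=
  (hasFDerivAt_modelFun_qPert g ε δ p).fderiv

/-! ### §2 Polarisation of the Levi form -/

/-- `‖P + Q‖² - ‖P - Q‖² = 4 Re(P̄ Q)` in `ℂ`. [folklore] -/
theorem norm_add_sq_sub_norm_sub_sq' (P Q : ℂ) :
    ‖P + Q‖ ^ 2 - ‖P - Q‖ ^ 2 = 4 * (conj P * Q).re := by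
  rw [Complex.sq_norm, Complex.sq_norm, Complex.normSq_apply, Complex.normSq_apply]
  simp only [Complex.add_re, Complex.add_im, Complex.sub_re, Complex.sub_im, Complex.mul_re,
    Complex.conj_re, Complex.conj_im]
  ring

/-- **Polarisation of a `J₀`-symmetrised Hessian**: for `h(u, v) = D²Ψ(u, v) + D²Ψ(J₀u, J₀v)`
with `D²Ψ` symmetric, `4 h(G, v) = h(G + v, G + v) - h(G - v, G - v)`. [folklore] -/
theorem levi_polar (A : EuclideanSpace ℝ (Fin 4) →L[ℝ] EuclideanSpace ℝ (Fin 4) →L[ℝ] ℝ)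
    (J₀ : EuclideanSpace ℝ (Fin 4) →L[ℝ] EuclideanSpace ℝ (Fin 4))
    (hsymm : ∀ u v, A u v = A v u) (G v : EuclideanSpace ℝ (Fin 4)) :
    4 * (A G v + A (J₀ G) (J₀ v)) =
      (A (G + v) (G + v) + A (J₀ (G + v)) (J₀ (G + v))) -
        (A (G - v) (G - v) + A (J₀ (G - v)) (J₀ (G - v))) := by
  have h1 := hsymm v G
  have h2 := hsymm (J₀ v) (J₀ G)
  simp only [map_add, map_sub, add_apply, sub_apply]
  linarith

/-- **The polarised Levi form of the model function**: if `D²Ψ` is the (symmetric) second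
derivative of `Ψ = modelFun g ε (qPert δ)` at `z`, then for all `G, v`
`D²Ψ(G, v) + D²Ψ(J₀G, J₀v) = 4Re(conj(Dw G) Dw v) + 4(Θ' + sΘ'' + ε) Re(conj(x(G)) x(v)) +
4εδμ(t) Re(conj(y(G)) y(v))`. [cite: CieliebakEliashberg2012, Ch. 2] -/
theorem levi_polar_modelFun (g : ℕ) (ε δ : ℝ) (z G v : EuclideanSpace ℝ (Fin 4)) :
    fderiv ℝ (fderiv ℝ (modelFun g ε (qPert δ))) z G v +
        fderiv ℝ (fderiv ℝ (modelFun g ε (qPert δ))) z (stdComplexStructure G)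
          (stdComplexStructure v) =
      4 * (conj (wD g z G) * wD g z v).re +
        4 * (deriv convexProfile (‖cx z‖ ^ 2) +
          ‖cx z‖ ^ 2 * deriv (deriv convexProfile) (‖cx z‖ ^ 2) + ε) * (conj (cx G) * cx v).re +
        4 * ε * δ * yMassLevi (‖cy z‖ ^ 2) * (conj (cy G) * cy v).re := by
  have hΨ : ContDiff ℝ ∞ (modelFun g ε (qPert δ)) := contDiff_modelFun g ε (contDiff_qPert δ)
  have hsymm : ∀ u u', fderiv ℝ (fderiv ℝ (modelFun g ε (qPert δ))) z u u' =
      fderiv ℝ (fderiv ℝ (modelFun g ε (qPert δ))) z u' u :=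
    fun u u' => ((hΨ.of_le (by norm_cast)).contDiffAt (x := z)).isSymmSndFDerivAt
      (n := 2) (by simp) u u'
  have hpol := levi_polar (fderiv ℝ (fderiv ℝ (modelFun g ε (qPert δ))) z) stdComplexStructure
    hsymm G v
  have hp := levi_modelFun_qPert g ε δ z (G + v)
  have hm := levi_modelFun_qPert g ε δ z (G - v)
  rw [hp, hm] at hpol
  have hxs : cx (G - v) = cx G - cx v := by rw [cx_eq]; exact map_sub cxL G v
  have hys : cy (G - v) = cy G - cy v := by rw [cy_eq]; exact map_sub cyL G v
  rw [fderiv_w, map_add, map_sub, cx_add, cy_add, hxs, hys] at hpol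
  have e1 := norm_add_sq_sub_norm_sub_sq' (wD g z G) (wD g z v)
  have e2 := norm_add_sq_sub_norm_sub_sq' (cx G) (cx v)
  have e3 := norm_add_sq_sub_norm_sub_sq' (cy G) (cy v)
  have key : 4 * (fderiv ℝ (fderiv ℝ (modelFun g ε (qPert δ))) z G v +
      fderiv ℝ (fderiv ℝ (modelFun g ε (qPert δ))) z (stdComplexStructure G)
        (stdComplexStructure v)) =
      4 * (4 * (conj (wD g z G) * wD g z v).re +
        4 * (deriv convexProfile (‖cx z‖ ^ 2) +
          ‖cx z‖ ^ 2 * deriv (deriv convexProfile) (‖cx z‖ ^ 2) + ε) * (conj (cx G) * cx v).re +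
        4 * ε * δ * yMassLevi (‖cy z‖ ^ 2) * (conj (cy G) * cy v).re) := by
    rw [hpol]
    linear_combination (4 : ℝ) * e1 +
      (4 * (deriv convexProfile (‖cx z‖ ^ 2) +
        ‖cx z‖ ^ 2 * deriv (deriv convexProfile) (‖cx z‖ ^ 2)) + 4 * ε) * e2 +
      (4 * ε * δ * yMassLevi (‖cy z‖ ^ 2)) * e3
  linarith

/-! ### §3 The two complex equations of the Levi gradient and the page-angle identity -/

/-- A complex number is determined by the real parts of its products with `1` and `i`:
if `Re(Z a) = Re(Z' a)` for all `a`, then `Z = Z'`. [folklore] -/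
theorem eq_of_forall_re_mul_eq {Z Z' : ℂ} (h : ∀ a : ℂ, (Z * a).re = (Z' * a).re) : Z = Z' := by
  have h1 := h 1
  have hI := h I
  simp only [mul_one] at h1
  simp only [Complex.mul_re, Complex.I_re, Complex.I_im, mul_zero, mul_one, zero_sub] at hI
  apply Complex.ext h1
  linarith

/-- **The equations of the Levi gradient.**  If `h(G, v) = DΨ(v)` for all `v` at `z` (for
`Ψ = modelFun g ε (qPert δ)`), then with `W = Dw G`, `A = x(G)`, `B = y(G)`, `p' = dP g x`,
`κ = Θ' + sΘ'' + ε`, `μ = yMassLevi t`, `m' = yMass' t`: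
`8ȳW + 4εδμB = 4ȳw + 2εδm'y` and `-4p̄'W + 4κA = -2p̄'w + 2(Θ'+ε)x`. [folklore] -/
theorem reeb_equations (g : ℕ) (ε δ : ℝ) (z G : EuclideanSpace ℝ (Fin 4))
    (hG : ∀ v, fderiv ℝ (fderiv ℝ (modelFun g ε (qPert δ))) z G v +
      fderiv ℝ (fderiv ℝ (modelFun g ε (qPert δ))) z (stdComplexStructure G)
        (stdComplexStructure v) = fderiv ℝ (modelFun g ε (qPert δ)) z v) :
    8 * conj (cy z) * wD g z G +
          4 * (ε * δ * yMassLevi (‖cy z‖ ^ 2) : ℝ) * cy G =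
        4 * conj (cy z) * w g z + 2 * (ε * δ * deriv yMass (‖cy z‖ ^ 2) : ℝ) * cy z ∧
      -4 * conj (dP g (cx z)) * wD g z G +
          4 * (deriv convexProfile (‖cx z‖ ^ 2) +
            ‖cx z‖ ^ 2 * deriv (deriv convexProfile) (‖cx z‖ ^ 2) + ε : ℝ) * cx G =
        -2 * conj (dP g (cx z)) * w g z +
          2 * (deriv convexProfile (‖cx z‖ ^ 2) + ε : ℝ) * cx z := by
  -- the identity `h(G, v) = DΨ(v)` in coordinates, for `v = mk a' b'`
  have key : ∀ a' b' : ℂ,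
      4 * (conj (wD g z G) * (2 * cy z * b' - dP g (cx z) * a')).re +
        4 * (deriv convexProfile (‖cx z‖ ^ 2) +
          ‖cx z‖ ^ 2 * deriv (deriv convexProfile) (‖cx z‖ ^ 2) + ε) * (conj (cx G) * a').re +
        4 * ε * δ * yMassLevi (‖cy z‖ ^ 2) * (conj (cy G) * b').re =
      2 * (conj (w g z) * (2 * cy z * b' - dP g (cx z) * a')).re +
        2 * deriv convexProfile (‖cx z‖ ^ 2) * (conj (cx z) * a').re +
        2 * ε * (conj (cx z) * a').re +
        2 * ε * δ * deriv yMass (‖cy z‖ ^ 2) * (conj (cy z) * b').re := by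
    intro a' b'
    have h1 := hG (mk a' b')
    rw [levi_polar_modelFun, fderiv_modelFun_qPert, modelFunD_apply, wD_apply' g z (mk a' b'),
      cx_mk, cy_mk] at h1
    exact h1
  constructor
  · -- the `b'`-equation (`a' = 0`)
    have hb : ∀ b' : ℂ,
        ((8 * cy z * conj (wD g z G) + 4 * ((ε * δ * yMassLevi (‖cy z‖ ^ 2) : ℝ) : ℂ) *
            conj (cy G)) * b').re =
          ((4 * cy z * conj (w g z) + 2 * ((ε * δ * deriv yMass (‖cy z‖ ^ 2) : ℝ) : ℂ) *
            conj (cy z)) * b').re := by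
      intro b'
      have h := key 0 b'
      simp only [Complex.mul_re, Complex.mul_im, Complex.add_re, Complex.add_im,
        Complex.ofReal_re, Complex.ofReal_im, Complex.conj_re, Complex.conj_im,
        Complex.re_ofNat, Complex.im_ofNat, Complex.zero_re, mul_zero,
        zero_mul, sub_zero, add_zero] at h ⊢
      linear_combination h
    have hZ := congrArg conj (eq_of_forall_re_mul_eq hb)
    simp only [map_add, map_mul, Complex.conj_conj, Complex.conj_ofReal, map_ofNat] at hZ
    linear_combination hZ
  · -- the `a'`-equation (`b' = 0`)
    have ha : ∀ a' : ℂ,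
        ((-4 * dP g (cx z) * conj (wD g z G) +
            4 * ((deriv convexProfile (‖cx z‖ ^ 2) +
              ‖cx z‖ ^ 2 * deriv (deriv convexProfile) (‖cx z‖ ^ 2) + ε : ℝ) : ℂ) *
              conj (cx G)) * a').re =
          ((-2 * dP g (cx z) * conj (w g z) +
            2 * ((deriv convexProfile (‖cx z‖ ^ 2) + ε : ℝ) : ℂ) * conj (cx z)) * a').re := by
      intro a'
      have h := key a' 0
      simp only [Complex.mul_re, Complex.mul_im, Complex.add_re, Complex.add_im,
        Complex.ofReal_re, Complex.ofReal_im, Complex.conj_re, Complex.conj_im,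
        Complex.re_ofNat, Complex.im_ofNat, Complex.zero_re, mul_zero,
        zero_mul, sub_zero, add_zero, zero_sub, Complex.neg_re, Complex.neg_im] at h ⊢
      linear_combination h
    have hZ := congrArg conj (eq_of_forall_re_mul_eq ha)
    simp only [map_add, map_mul, map_neg, Complex.conj_conj, Complex.conj_ofReal, map_ofNat,
      neg_mul] at hZ
    linear_combination hZ

/-- **The page-angle identity** (pure algebra): from the two gradient equations and
`W = 2yB - p'A`,
`W (16 ȳy κ + 4εδμ (p̄'p' + κ)) = (8 ȳy κ + 2εδμ p̄'p') w + 4εδκ m' y² - 2εδμ Θ₁ p' x`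
(`Θ₁ = Θ' + ε`). [folklore] -/
theorem reeb_W_identity {W A B w x y p' : ℂ} {ε δ μ m' κ Θ₁ : ℝ}
    (e1 : 8 * conj y * W + 4 * (ε * δ * μ : ℝ) * B = 4 * conj y * w + 2 * (ε * δ * m' : ℝ) * y)
    (e2 : -4 * conj p' * W + 4 * (κ : ℂ) * A = -2 * conj p' * w + 2 * (Θ₁ : ℂ) * x)
    (e3 : W = 2 * y * B - p' * A) :
    W * (16 * (conj y * y) * κ + 4 * (ε * δ * μ : ℝ) * (conj p' * p' + κ)) =
      (8 * (conj y * y) * κ + 2 * (ε * δ * μ : ℝ) * (conj p' * p')) * w +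
        4 * (ε * δ * m' : ℝ) * κ * y ^ 2 - 2 * (ε * δ * μ : ℝ) * Θ₁ * p' * x := by
  linear_combination (2 * y * (κ : ℂ)) * e1 - ((ε * δ * μ : ℝ) * p') * e2 +
    (4 * (ε * δ * μ : ℝ) * (κ : ℂ)) * e3

/-- **`W = Dw(G)` on the model**: with `κ = Θ'(s) + sΘ''(s) + ε`, `μ = yMassLevi t`,
`m' = yMass' t`, `p' = dP g x`, `Θ₁ = Θ'(s) + ε` (`s = ‖x‖²`, `t = ‖y‖²`),
`Dw(G) · (16tκ + 4εδμ(‖p'‖² + κ)) = (8tκ + 2εδμ‖p'‖²) w + 4εδκ m' y² - 2εδμ Θ₁ p' x`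
whenever `h(G, ·) = DΨ(·)` at `z`. [folklore] -/
theorem reeb_W_identity_modelFun (g : ℕ) (ε δ : ℝ) (z G : EuclideanSpace ℝ (Fin 4))
    (hG : ∀ v, fderiv ℝ (fderiv ℝ (modelFun g ε (qPert δ))) z G v +
      fderiv ℝ (fderiv ℝ (modelFun g ε (qPert δ))) z (stdComplexStructure G)
        (stdComplexStructure v) = fderiv ℝ (modelFun g ε (qPert δ)) z v) :
    wD g z G * (16 * (conj (cy z) * cy z) *
        (deriv convexProfile (‖cx z‖ ^ 2) +
          ‖cx z‖ ^ 2 * deriv (deriv convexProfile) (‖cx z‖ ^ 2) + ε : ℝ) +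
        4 * (ε * δ * yMassLevi (‖cy z‖ ^ 2) : ℝ) * (conj (dP g (cx z)) * dP g (cx z) +
          (deriv convexProfile (‖cx z‖ ^ 2) +
            ‖cx z‖ ^ 2 * deriv (deriv convexProfile) (‖cx z‖ ^ 2) + ε : ℝ))) =
      (8 * (conj (cy z) * cy z) *
          (deriv convexProfile (‖cx z‖ ^ 2) +
            ‖cx z‖ ^ 2 * deriv (deriv convexProfile) (‖cx z‖ ^ 2) + ε : ℝ) +
        2 * (ε * δ * yMassLevi (‖cy z‖ ^ 2) : ℝ) * (conj (dP g (cx z)) * dP g (cx z))) * w g z +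
        4 * (ε * δ * deriv yMass (‖cy z‖ ^ 2) : ℝ) *
          (deriv convexProfile (‖cx z‖ ^ 2) +
            ‖cx z‖ ^ 2 * deriv (deriv convexProfile) (‖cx z‖ ^ 2) + ε : ℝ) * cy z ^ 2 -
        2 * (ε * δ * yMassLevi (‖cy z‖ ^ 2) : ℝ) * (deriv convexProfile (‖cx z‖ ^ 2) + ε : ℝ) *
          dP g (cx z) * cx z := by
  obtain ⟨e1, e2⟩ := reeb_equations g ε δ z G hG
  have e3 : wD g z G = 2 * cy z * cy G - dP g (cx z) * cx G := wD_apply' g z G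
  exact reeb_W_identity e1 e2 e3

/-- **Near the binding the Levi gradient moves the page angle at rate `1/2`**: where
`‖y‖² > 3/10` (so `μ = m' = 0`) and `κ > 0`, `y ≠ 0`: `Dw(G) = w/2`. [folklore] -/
theorem wD_leviGradient_of_gt (g : ℕ) {ε δ : ℝ} (z G : EuclideanSpace ℝ (Fin 4))
    (hG : ∀ v, fderiv ℝ (fderiv ℝ (modelFun g ε (qPert δ))) z G v +
      fderiv ℝ (fderiv ℝ (modelFun g ε (qPert δ))) z (stdComplexStructure G)
        (stdComplexStructure v) = fderiv ℝ (modelFun g ε (qPert δ)) z v)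
    (ht : 3 / 10 < ‖cy z‖ ^ 2)
    (hκ : 0 < deriv convexProfile (‖cx z‖ ^ 2) +
      ‖cx z‖ ^ 2 * deriv (deriv convexProfile) (‖cx z‖ ^ 2) + ε) :
    wD g z G = w g z / 2 := by
  have h := reeb_W_identity_modelFun g ε δ z G hG
  rw [yMassLevi_of_gt ht, deriv_yMass_of_gt ht] at h
  simp only [mul_zero, Complex.ofReal_zero, zero_mul, add_zero, sub_zero] at h
  have hy : (conj (cy z) * cy z : ℂ) = ((‖cy z‖ ^ 2 : ℝ) : ℂ) := by
    rw [Complex.conj_mul', ← Complex.ofReal_pow]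
  rw [hy] at h
  have hne : ((16 * ‖cy z‖ ^ 2 *
      (deriv convexProfile (‖cx z‖ ^ 2) +
        ‖cx z‖ ^ 2 * deriv (deriv convexProfile) (‖cx z‖ ^ 2) + ε) : ℝ) : ℂ) ≠ 0 := by
    rw [Complex.ofReal_ne_zero]
    have : 0 < ‖cy z‖ ^ 2 := by linarith
    positivity
  have h' : wD g z G * ((16 * ‖cy z‖ ^ 2 *
      (deriv convexProfile (‖cx z‖ ^ 2) +
        ‖cx z‖ ^ 2 * deriv (deriv convexProfile) (‖cx z‖ ^ 2) + ε) : ℝ) : ℂ) =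
      (w g z / 2) * ((16 * ‖cy z‖ ^ 2 *
        (deriv convexProfile (‖cx z‖ ^ 2) +
          ‖cx z‖ ^ 2 * deriv (deriv convexProfile) (‖cx z‖ ^ 2) + ε) : ℝ) : ℂ) := by
    push_cast at h ⊢
    linear_combination h
  exact mul_right_cancel₀ hne h'

end Literature.Geometry.Symplectic

end
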